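import Literature.AlgebraicGeometry.Resolution.LocalBlowup
import Literature.AlgebraicGeometry.Resolution.RankOneReductionProofs
import HarnessLib

/-!
# Residues of the local ring at the centre of `ν` = the local ring at the centre of `ν̄` of the residues (bridge lemma for the residue-side driver)

Route `RadicialJung`, crux `CleanModels` (stmt-ResolutionOfSingularities-15917), registered skeleton `Cruxes/CleanModels/Lines/Sketch.lean`
rev 35 (sha16 de44649d8f729c3b), stub 7 `stub_cleanModelsDimGEFour`.  Explicit-unit seat `decomp-res-hand-2` g5 (structural hand); memo
`Cruxes/CleanModels/Lines/Sketch-memo-hand2-g5-stubs-5-7.md` §3 item 2(c).  OURS; structural bookkeeping, counted 0; nothing here proves resolution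
of singularities in characteristic `p`.

For `ν = ν₁ ∘ ν₂` with rings `O ≤ O₁`, residue field `F = κ(O₁)`, residue valuation ring `Ō = O / 𝔪_{O₁} ⊆ F` (tree `residueValuationSubring`) and
the residue map `ρ : O₁ → F`, and a subring `B ⊆ O` of `K`:

* `valuation_eq_one_iff_residue` — for `y ∈ O`: `ν(y) = 0` iff `ν̄(ρ y) = 0` (units correspond);
* `range_residue_locAtCentre` — **`ρ(locAtCentre B O) = locAtCentre (ρ B) Ō`** as subrings of `F`: the residues of the local ring of `B` at the
  centre of `ν` form exactly the local ring of the residue ring `ρ(B)` at the centre of `ν̄`.  With ✓ `locAtCentre_locAtCentre` and monotonicity this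
  identifies, step by step, the residue rings of the lifted models (✓ `centre_locAtCentre_adjoin_div_le_map`, ✓ `locGen_sup_adjoin_div`) with the
  stages of a residue-side chain of local blowing ups (`ELU3Coord` of the g5 spec).
[cite: NovacoskiSpivakovsky2014, Remark 2.4 and Lemma 2.15]
-/

noncomputable section

set_option linter.dupNamespace false -- mandated namespace of this single-conjunct summit

open IsLocalRing
open Literature.AlgebraicGeometry.Resolution

namespace Summit.ResolutionOfSingularities.ResolutionOfSingularities.Theorems.RadicialJung.CleanModels

variable {K : Type} [Field K]

/-- For `y ∈ O`: `ν(y) = 0` iff the residue of `y` in `κ(O₁)` has `ν̄`-value `0`. [folklore] -/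
theorem valuation_eq_one_iff_residue (O O₁ : ValuationSubring K) (hO : O ≤ O₁) (y : K) (hy : y ∈ O) :
    O.valuation y = 1 ↔ (residueValuationSubring O O₁ hO).valuation (residue O₁ ⟨y, hO hy⟩) = 1 := by
  have h1 : O.valuation y ≤ 1 := (O.valuation_le_one_iff _).mpr hy
  have hmem : residue O₁ ⟨y, hO hy⟩ ∈ residueValuationSubring O O₁ hO :=
    (residue_mem_residueValuationSubring_iff O O₁ hO ⟨y, hO hy⟩).mpr hy
  have h2 : (residueValuationSubring O O₁ hO).valuation (residue O₁ ⟨y, hO hy⟩) ≤ 1 :=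
    ((residueValuationSubring O O₁ hO).valuation_le_one_iff _).mpr hmem
  have hlt := valuation_lt_one_iff_residue O O₁ hO y hy
  constructor
  · intro h
    exact le_antisymm h2 (not_lt.mp fun h' => (lt_irrefl _) (h ▸ hlt.mpr h'))
  · intro h
    exact le_antisymm h1 (not_lt.mp fun h' => (lt_irrefl _) (h ▸ hlt.mp h'))

/-- **`ρ(locAtCentre B O) = locAtCentre (ρ B) Ō`.** For `B ⊆ O` the residues (in `κ(O₁)`) of the local ring of `B` at the centre of `ν` are exactly
the local ring, at the centre of the residue valuation `ν̄`, of the ring of residues of `B`. [cite: NovacoskiSpivakovsky2014, Lemma 2.15] -/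
theorem range_residue_locAtCentre (O O₁ : ValuationSubring K) (hO : O ≤ O₁) (B : Subring K) (hB : B ≤ O.toSubring) :
    ((residue O₁).comp (Subring.inclusion ((locAtCentre_le hB).trans hO))).range =
      locAtCentre ((residue O₁).comp (Subring.inclusion (hB.trans hO))).range (residueValuationSubring O O₁ hO) := by
  set Ō := residueValuationSubring O O₁ hO with hŌdef
  set ρB : Subring (ResidueField O₁) := ((residue O₁).comp (Subring.inclusion (hB.trans hO))).range with hρBdef
  have hmemρB : ∀ (y : K) (hy : y ∈ B), residue O₁ ⟨y, hO (hB hy)⟩ ∈ ρB := fun y hy => ⟨⟨y, hy⟩, rfl⟩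
  apply le_antisymm
  · rintro _ ⟨f, rfl⟩
    obtain ⟨y, hy, e, he, he1, hf⟩ := (mem_locAtCentre_iff).mp f.2
    have he0 : e ≠ 0 := ne_zero_of_valuation_eq_one he1
    have hyO : y ∈ O := hB hy
    have heO : e ∈ O := hB he
    have he1' : O₁.valuation e = 1 := by
      apply le_antisymm ((O₁.valuation_le_one_iff _).mpr (hO heO))
      have hinvO : e⁻¹ ∈ O := (O.valuation_le_one_iff _).mp (by rw [map_inv₀, he1, inv_one])
      have h2 : O₁.valuation e⁻¹ ≤ 1 := (O₁.valuation_le_one_iff _).mpr (hO hinvO)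
      rw [map_inv₀] at h2
      exact (inv_le_one₀ (by rw [Valuation.pos_iff]; exact he0)).mp h2
    have hres : ((residue O₁).comp (Subring.inclusion ((locAtCentre_le hB).trans hO))) f =
        residue O₁ ⟨y, hO hyO⟩ / residue O₁ ⟨e, hO heO⟩ := by
      have hfO₁ : y / e ∈ O₁ := hf ▸ hO (locAtCentre_le hB f.2)
      have : ((residue O₁).comp (Subring.inclusion ((locAtCentre_le hB).trans hO))) f = residue O₁ ⟨y / e, hfO₁⟩ := by
        change residue O₁ _ = _
        congr 1
        exact Subtype.ext hf
      rw [this, residue_div O₁ y e (hO hyO) (hO heO) he1' hfO₁]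
    rw [hres]
    refine (mem_locAtCentre_iff).mpr ⟨_, hmemρB y hy, _, hmemρB e he, ?_, rfl⟩
    exact (valuation_eq_one_iff_residue O O₁ hO e heO).mp he1
  · intro x hx
    obtain ⟨yb, hyb, eb, heb, heb1, hx⟩ := (mem_locAtCentre_iff).mp hx
    obtain ⟨⟨y, hy⟩, rfl⟩ := hyb
    obtain ⟨⟨e, he⟩, rfl⟩ := heb
    have hyO : y ∈ O := hB hy
    have heO : e ∈ O := hB he
    change Ō.valuation (residue O₁ ⟨e, hO heO⟩) = 1 at heb1
    have he1 : O.valuation e = 1 := (valuation_eq_one_iff_residue O O₁ hO e heO).mpr heb1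
    have he0 : e ≠ 0 := ne_zero_of_valuation_eq_one he1
    have he1' : O₁.valuation e = 1 := by
      apply le_antisymm ((O₁.valuation_le_one_iff _).mpr (hO heO))
      have hinvO : e⁻¹ ∈ O := (O.valuation_le_one_iff _).mp (by rw [map_inv₀, he1, inv_one])
      have h2 : O₁.valuation e⁻¹ ≤ 1 := (O₁.valuation_le_one_iff _).mpr (hO hinvO)
      rw [map_inv₀] at h2
      exact (inv_le_one₀ (by rw [Valuation.pos_iff]; exact he0)).mp h2
    have hfmem : y / e ∈ locAtCentre B O := (mem_locAtCentre_iff).mpr ⟨y, hy, e, he, he1, rfl⟩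
    refine ⟨⟨y / e, hfmem⟩, ?_⟩
    have hfO₁ : y / e ∈ O₁ := hO (locAtCentre_le hB hfmem)
    change residue O₁ ⟨y / e, hfO₁⟩ = x
    rw [hx, residue_div O₁ y e (hO hyO) (hO heO) he1' hfO₁]
    rfl

end Summit.ResolutionOfSingularities.ResolutionOfSingularities.Theorems.RadicialJung.CleanModels

end
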